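import Literature.Topology.FourManifolds.LinkingNumberTorusClassModel
import Literature.Topology.FourManifolds.TorusMapDegree
import Literature.Topology.FourManifolds.CircleMapWinding
import Literature.Topology.FourManifolds.LinkingNumberWellDefinedHolds
import Literature.Topology.FourManifolds.KirbyMovesSlideModel
import Literature.Topology.FourManifolds.DehnSurgeryTwistProofs
import Literature.Topology.FourManifolds.LinkTubularNbhd
import HarnessLib

/-!
# Symmetry of the linking number (proof): `lk(K, J) = lk(J, K)`

Topic `Literature/Topology/FourManifolds`. This file **discharges the named fact**
`Literature.Topology.FourManifolds.Knot.HasLinkingNumber.symm` of `LinkingNumber.lean`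
(D. Rolfsen, *Knots and Links* (1976), §5.D, Thm. 5.D.1: the eight definitions of the linking
number agree, in particular the asymmetric definition (2), `lk(K, J) = [J] ∈ H₁(S³ ∖ K)`, is
symmetric) as `Knot.HasLinkingNumber.symm_holds`, assembling the homological proof prepared in

* `LinkingNumberTorusClass.lean` — the torus classes `[∂N(K)]`, `[∂N(J)]` of disjoint oriented
  tubes cancel in `H₂(S³ ∖ (K ∪ J); ℤ)` and are nonzero (Mayer–Vietoris applied to `[S³]`);
* `TubeOrientationTransport.lean`, `LinkingNumberTorusClassModel.lean` — both torus classes are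
  push-forwards of one class `τ` of the model punctured tube `S¹ × (ℝ² ∖ 0)` (the orientation
  convention `det_pos`);
* `TorusMapDegree.lean` — `(x, u) ↦ (u, x^b)` acts as `-b` and `(x, u) ↦ (x^a, u)` as `a` on
  `H₂(T²; ℤ)`, which has no torsion;
* `CircleMapWinding.lean` — winding numbers of circle-valued maps and the homotopy classification
  of torus maps `T² → S¹` by their two degrees.

## The proof (`Knot.HasLinkingNumber.symm_holds`)

Let `lk(K, J) = l`. Choose disjoint `0`-framed oriented tubes `ν_K`, `ν_J` (tubes inside disjoint
neighbourhoods, `Knot.exists_tubularNbhd_range_subset`, re-framed without moving,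
`exists_hasFraming_range_eq`), a `ℤ`-orientation `μ` of `S³`, and circle-valued maps
`Θ_K : S³ ∖ K → S¹`, `Θ_J : S³ ∖ J → S¹` realising the winding homomorphisms
`φ_K, φ_J : π₁ → ℤ` (`[γ]ᵃᵇ = [meridian]ᵃᵇ ^ φ(γ)`; Hatcher Prop. 1B.9 in the tree's form
`exists_contMDiff_circleMap_realising`), so that the winding number of `Θ` along any loop at the
base point is `φ` of its class, and along any loop anywhere is computed after conjugation. Map
`S³ ∖ (K ∪ J)` to the torus `T² = S¹ × S¹` by `Φ = (Θ_K, Θ_J)` and precompose with the tubes on the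
torus `x, u ↦ ν(x, u/2)`: the cancellation of the torus classes becomes
`(G_K)_* τ' + (G_J)_* τ' = 0` in `H₂(T²; ℤ)` with `τ' ≠ 0`, for `G_K = Φ ∘ ν_K`, `G_J = Φ ∘ ν_J`.
The four degrees of `G_K` are: `Θ_K` along the `0`-framed longitude of `K`: `0`; along the meridian
of `K`: `1`; `Θ_J` along the longitude of `K` = the push-off of `K`: `lk(J, push-off) =: b`;
along the meridian of `K`, which bounds a disc missing `J`: `0`. Hence `G_K ≃ (u, x^b)` acts as
`-b`; symmetrically `G_J ≃ (x^a, u)` with `a = lk(K, push-off of J) = lk(K, J) = l` acts as `l`.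
So `(l - b) τ' = 0`, `b = l`, and `lk(J, K) = lk(J, push-off of K) = b = l`
(`hasLinkingNumber_pushOff_iff_right`).

Everything is proved; the only new data are the packaging structure `WindingData` and the torus
parametrisations. No named fact is introduced; the fact `Knot.HasLinkingNumber.symm` is discharged.

## References

* D. Rolfsen, *Knots and Links*, Publish or Perish (1976), §5.D, Thm. 5.D.1 and definition (2).
  [cite: Rolfsen1976, §5.D Thm 5.D.1]
* A. Hatcher, *Algebraic Topology*, CUP (2002), §1.1 Thm. 1.7, Prop. 1B.9, §2.2, §3.3.
  [cite: HatcherAT2002, §2.2 pp. 149–150]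
-/

noncomputable section

open CategoryTheory Set Function Metric
open scoped Manifold Topology Real unitInterval
open Literature.AlgebraicTopology.SingularHomology

namespace Literature.Topology.FourManifolds

/-- Local notation: `𝔼 n` is the model Euclidean space `EuclideanSpace ℝ (Fin n)`. -/
local notation "𝔼 " n:arg => EuclideanSpace ℝ (Fin n)

/-- Local notation: `𝕊 n` is the unit sphere in `EuclideanSpace ℝ (Fin (n + 1))`. -/
local notation "𝕊 " n:arg => (Metric.sphere (0 : EuclideanSpace ℝ (Fin (n + 1))) 1)

attribute [local instance] fact_finrank_euclideanSpace_two fact_finrank_euclideanSpace_four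

/-- Local notation for the homotopy class of a path (as in `SeifertCircleMapProofs.lean`). -/
local notation "⟦" p "⟧ₚ" => Path.Homotopic.Quotient.mk p

/-! ### The circle group and the Euclidean circle -/

/-- The homeomorphism `Circle ≃ₜ 𝕊¹` as a function into `ℝ²`. [folklore] -/
theorem coe_circleHomeomorphSphereOne (z : Circle) :
    ((circleHomeomorphSphereOne z : 𝕊 1) : 𝔼 2) = Complex.orthonormalBasisOneI.repr (z : ℂ) := rfl

/-- `Circle ≃ₜ 𝕊¹` sends `e^{is}` to `circlePoint s`. [folklore] -/
theorem circleHomeomorphSphereOne_exp (s : ℝ) :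
    circleHomeomorphSphereOne (Circle.exp s) = circlePoint s := by
  apply Subtype.ext
  rw [coe_circleHomeomorphSphereOne]
  ext i
  rw [Complex.orthonormalBasisOneI_repr_apply]
  fin_cases i
  · simp [circlePoint_apply_zero, Circle.coe_exp, Complex.exp_ofReal_mul_I_re]
  · simp [circlePoint_apply_one, Circle.coe_exp, Complex.exp_ofReal_mul_I_im]

/-- `Circle ≃ₜ 𝕊¹` sends `1` to `circlePoint 0`. [folklore] -/
theorem circleHomeomorphSphereOne_one : circleHomeomorphSphereOne 1 = circlePoint 0 := by
  rw [← Circle.exp_zero, circleHomeomorphSphereOne_exp]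

/-- The inverse homeomorphism sends `circlePoint s` to `e^{is}`. [folklore] -/
theorem circleHomeomorphSphereOne_symm_circlePoint (s : ℝ) :
    circleHomeomorphSphereOne.symm (circlePoint s) = Circle.exp s := by
  rw [← circleHomeomorphSphereOne_exp, Homeomorph.symm_apply_apply]

/-- Conjugation invariance of winding numbers, left-associated form
(`(δ · γ) · δ⁻¹`). [folklore] -/
theorem CircleMaps.winding_conj' {X : Type*} [TopologicalSpace X] (f : C(X, Circle)) {x y : X}
    (δ : Path y x) (γ : Path x x) :
    CircleMaps.winding f ((δ.trans γ).trans δ.symm) = CircleMaps.winding f γ := by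
  rw [CircleMaps.winding_eq_iff, CircleMaps.incr_trans, CircleMaps.incr_trans, CircleMaps.incr_symm,
    CircleMaps.incr_eq_winding]
  ring

/-! ### Winding data of an oriented tubular neighbourhood -/

namespace Knot.TubularNbhd

variable {K : Knot} (ν : Knot.TubularNbhd K)

/-- **Winding data**: the winding homomorphism `φ` on loops at the base point of `ν`
(`[γ]ᵃᵇ = [meridian]ᵃᵇ ^ φ(γ)`, `φ(meridian) = 1`) and a circle-valued map `Θ : S³ ∖ K → S¹`
whose winding number along every loop at the base point is `φ` (Hatcher 2002, Prop. 1B.9; tree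
`exists_contMDiff_circleMap_realising`, `exists_windingFun`). [cite: HatcherAT2002, Prop. 1B.9] -/
structure WindingData where
  /-- The winding homomorphism. -/
  φ : Path.Homotopic.Quotient ν.basePoint ν.basePoint → ℤ
  /-- Additivity. -/
  φ_add : ∀ p q, φ (p.trans q) = φ p + φ q
  /-- The characterisation in the abelianised fundamental group. -/
  φ_char : ∀ p, Abelianization.of (FundamentalGroup.fromPath p) =
    Abelianization.of (FundamentalGroup.fromPath ⟦ν.meridian⟧ₚ) ^ φ p
  /-- The meridian winds once. -/
  φ_meridian : φ ⟦ν.meridian⟧ₚ = 1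
  /-- The circle-valued map. -/
  Θ : C(K.complement, Circle)
  /-- Its winding numbers at the base point are `φ`. -/
  winding_Θ : ∀ γ : Path ν.basePoint ν.basePoint, CircleMaps.winding Θ γ = φ ⟦γ⟧ₚ

/-- **Winding data exist.** [cite: HatcherAT2002, Prop. 1B.9] -/
theorem WindingData.nonempty : Nonempty (WindingData ν) := by
  obtain ⟨φ, hadd, hchar, hmer⟩ := ν.exists_windingFun
  haveI : PathConnectedSpace K.complement := ν.pathConnectedSpace_complement
  haveI : LocallyCompactSpace K.complement := ChartedSpace.locallyCompactSpace (𝔼 3) _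
  haveI : SigmaCompactSpace K.complement := sigmaCompactSpace_of_locallyCompact_secondCountable
  have hrefl : φ (Path.Homotopic.Quotient.refl ν.basePoint) = 0 := by
    have h := hadd (Path.Homotopic.Quotient.refl _) (Path.Homotopic.Quotient.refl _)
    rw [Path.Homotopic.Quotient.refl_trans] at h
    linarith
  let φm : FundamentalGroup K.complement ν.basePoint →* Multiplicative ℤ :=
    { toFun := fun g => Multiplicative.ofAdd (φ (FundamentalGroup.toPath g))
      map_one' := by
        show Multiplicative.ofAdd (φ (Path.Homotopic.Quotient.refl ν.basePoint)) = 1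
        rw [hrefl]
        rfl
      map_mul' := fun a b => by
        show Multiplicative.ofAdd (φ ((FundamentalGroup.toPath b).trans (FundamentalGroup.toPath a)))
          = Multiplicative.ofAdd (φ (FundamentalGroup.toPath a)) *
            Multiplicative.ofAdd (φ (FundamentalGroup.toPath b))
        rw [hadd, add_comm, ofAdd_add] }
  obtain ⟨θ, hθ, hang⟩ := exists_contMDiff_circleMap_realising (E := 𝔼 3) ν.basePoint φm
  let Θ : C(K.complement, Circle) :=
    ⟨fun z ↦ circleHomeomorphSphereOne.symm (θ z),
      circleHomeomorphSphereOne.symm.continuous.comp hθ.continuous⟩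
  refine ⟨⟨φ, hadd, hchar, hmer, Θ, fun γ ↦ ?_⟩⟩
  obtain ⟨A, hA, hθA, hinc⟩ := hang γ
  refine CircleMaps.winding_eq_of_lift Θ γ (G := fun t ↦ 2 * π * A t) (by fun_prop)
    (fun t ↦ ?_) (φ ⟦γ⟧ₚ) ?_
  · show Circle.exp (2 * π * A t) = circleHomeomorphSphereOne.symm (θ (γ t))
    rw [hθA, circleHomeomorphSphereOne_symm_circlePoint]
  · rw [← mul_sub, hinc]
    show 2 * π * (Multiplicative.toAdd (Multiplicative.ofAdd (φ _)) : ℝ) = _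
    rw [toAdd_ofAdd]
    ring

namespace WindingData

variable {ν} (W : WindingData ν)

/-- For a `0`-framed tube the longitude does not wind. [folklore] -/
theorem φ_longitude (h0 : ν.HasFraming 0) : W.φ ⟦ν.longitude⟧ₚ = 0 :=
  ν.windingFun_longitude_eq_zero h0 W.φ_char

/-- The winding homomorphism is read off the class in the abelianised fundamental group.
[folklore] -/
theorem φ_eq_of_abelianization_eq {p : Path.Homotopic.Quotient ν.basePoint ν.basePoint} {b : ℤ}
    (h : Abelianization.of (FundamentalGroup.fromPath p) =
      Abelianization.of (FundamentalGroup.fromPath ⟦ν.meridian⟧ₚ) ^ b) : W.φ p = b := by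
  apply ν.zpow_abelianization_meridian_injective
  show _ ^ W.φ p = _ ^ b
  rw [← W.φ_char, h]

/-- **The winding number of `Θ` along a knot disjoint from `K` is the linking number**
`lk(K, L)`: `lk(K, L) = b` says `[γ · L · γ⁻¹]ᵃᵇ = [meridian]ᵃᵇ ^ b` for a path `γ` from the base
point (independence of the choices, `hasLinkingNumber_iff_forall_holds`), so the winding along
`γ · L · γ⁻¹` is `b`, and conjugation does not change winding numbers. [folklore] -/
theorem winding_loopInCompl {L : Knot} (hKL : Disjoint (range ⇑K) (range ⇑L)) {b : ℤ}
    (hb : K.HasLinkingNumber L hKL b) : CircleMaps.winding W.Θ (K.loopInCompl L hKL) = b := by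
  haveI : PathConnectedSpace K.complement := ν.pathConnectedSpace_complement
  let γ : Path ν.basePoint ⟨L (circlePoint 0), Knot.mem_complement_of_disjoint hKL _⟩ :=
    PathConnectedSpace.somePath _ _
  have h := (hasLinkingNumber_iff_forall_holds K L hKL b).1 hb ν γ
  have hφ := W.φ_eq_of_abelianization_eq h
  rw [← W.winding_Θ] at hφ
  rwa [CircleMaps.winding_conj'] at hφ

end WindingData

end Knot.TubularNbhd

/-! ### Winding numbers along circles bounding discs in the complement -/

/-- **A circle-valued map defined on an open disc has winding number zero along any loop in the
disc that closes up in the parameter**: the map lifts to `ℝ` over the simply connected disc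
(Hatcher 2002, Prop. 1.33). Used for meridian circles of one knot seen by the circle map of the
other. [cite: HatcherAT2002, Prop. 1.33] -/
theorem CircleMaps.winding_eq_zero_of_factors_through_ball {X : Type*} [TopologicalSpace X]
    (f : C(X, Circle)) {x : X} (γ : Path x x)
    (g : C(↥(ball (0 : 𝔼 2) 1), X)) (c : I → ↥(ball (0 : 𝔼 2) 1)) (hc : Continuous c)
    (hcγ : ∀ t, g (c t) = γ t) (h01 : c 0 = c 1) : CircleMaps.winding f γ = 0 := by
  haveI : ContractibleSpace ↥(ball (0 : 𝔼 2) 1) :=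
    (convex_ball (0 : 𝔼 2) 1).contractibleSpace ⟨0, mem_ball_self one_pos⟩
  haveI : LocallyPathConnectedSpace ↥(ball (0 : 𝔼 2) 1) :=
    isOpen_ball.isOpenEmbedding_subtypeVal.locallyPathConnectedSpace
  obtain ⟨Λ, ⟨-, hΛ⟩, -⟩ := Circle.isCoveringMap_exp.existsUnique_continuousMap_lifts (f.comp g)
    (c 0) ((f (g (c 0)) : ℂ).arg) (by simp [Circle.exp_arg])
  refine CircleMaps.winding_eq_of_lift f γ (G := fun t ↦ Λ (c t)) (Λ.continuous.comp hc)
    (fun t ↦ ?_) 0 ?_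
  · have := congr_fun hΛ (c t)
    simp only [Function.comp_apply, ContinuousMap.comp_apply] at this
    rw [this, hcγ]
  · rw [h01]; simp

/-! ### The torus parametrisation of the punctured model tube -/

/-- **The torus in the punctured model tube**: `(x, u) ↦ (x, u/2)` (radius `½`, the radius of the
base vector `framingBaseVector` of the tree's meridians and longitudes). [folklore] -/
def torusIncl : C(CircleTorus, ↥puncturedModel) where
  toFun z := ⟨(circleHomeomorphSphereOne z.1, (1 / 2 : ℝ) • ((circleHomeomorphSphereOne z.2 : 𝕊 1) : 𝔼 2)),
    by
      rw [mem_puncturedModel]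
      exact smul_ne_zero (by norm_num) (ne_zero_of_mem_unit_sphere _)⟩
  continuous_toFun := by
    refine Continuous.subtype_mk ?_ _
    fun_prop

/-- The torus parametrisation as a function. [folklore] -/
@[simp] theorem torusIncl_apply_coe (z : CircleTorus) : (torusIncl z : (𝕊 1) × 𝔼 2) =
    (circleHomeomorphSphereOne z.1, (1 / 2 : ℝ) • ((circleHomeomorphSphereOne z.2 : 𝕊 1) : 𝔼 2)) :=
  rfl

/-- The unit vector of a nonzero vector of the plane, as a point of the circle. [folklore] -/
def unitOf (w : 𝔼 2) (hw : w ≠ 0) : 𝕊 1 :=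
  ⟨‖w‖⁻¹ • w, by rw [mem_sphere_zero_iff_norm, norm_smul, norm_inv, norm_norm, inv_mul_cancel₀ (norm_ne_zero_iff.2 hw)]⟩

/-- **The retraction of the punctured model tube onto the torus**, `(y, w) ↦ (y, w/‖w‖)`.
[folklore] -/
def torusRetr : C(↥puncturedModel, CircleTorus) where
  toFun m := (circleHomeomorphSphereOne.symm m.1.1,
    circleHomeomorphSphereOne.symm (unitOf m.1.2 m.2))
  continuous_toFun := by
    have h1 : Continuous fun m : ↥puncturedModel ↦ (m : (𝕊 1) × 𝔼 2).1 :=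
      continuous_fst.comp continuous_subtype_val
    have h2 : Continuous fun m : ↥puncturedModel ↦ (m : (𝕊 1) × 𝔼 2).2 :=
      continuous_snd.comp continuous_subtype_val
    have hn : Continuous fun m : ↥puncturedModel ↦ ‖(m : (𝕊 1) × 𝔼 2).2‖⁻¹ :=
      (continuous_norm.comp h2).inv₀ fun m ↦ norm_ne_zero_iff.2 m.2
    exact (circleHomeomorphSphereOne.symm.continuous.comp h1).prodMk
      (circleHomeomorphSphereOne.symm.continuous.comp (Continuous.subtype_mk (hn.smul h2) _))

/-- `torusIncl ∘ torusRetr ≃ id`: the radial homotopy `w ↦ ((1 - t)/(2‖w‖) + t) w` in `ℝ² ∖ 0`.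
[folklore] -/
theorem torusIncl_comp_torusRetr_homotopic :
    (torusIncl.comp torusRetr).Homotopic (ContinuousMap.id ↥puncturedModel) := by
  refine ⟨{ toFun := fun p ↦ ⟨(p.2.1.1, ((1 - (p.1 : ℝ)) / (2 * ‖p.2.1.2‖) + (p.1 : ℝ)) • p.2.1.2), ?_⟩
            continuous_toFun := ?_
            map_zero_left := fun m ↦ ?_
            map_one_left := fun m ↦ ?_ }⟩
  · rw [mem_puncturedModel]
    refine smul_ne_zero (ne_of_gt ?_) p.2.2
    have hn : 0 < ‖p.2.1.2‖ := norm_pos_iff.2 p.2.2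
    have ht0 : 0 ≤ (p.1 : ℝ) := p.1.2.1
    have ht1 : (p.1 : ℝ) ≤ 1 := p.1.2.2
    rcases eq_or_lt_of_le ht1 with h | h
    · rw [h]; norm_num
    · have : 0 < (1 - (p.1 : ℝ)) / (2 * ‖p.2.1.2‖) := div_pos (by linarith) (by positivity)
      linarith
  · have h1 : Continuous fun p : I × ↥puncturedModel ↦ (p.2 : (𝕊 1) × 𝔼 2).1 :=
      continuous_fst.comp (continuous_subtype_val.comp continuous_snd)
    have h2 : Continuous fun p : I × ↥puncturedModel ↦ (p.2 : (𝕊 1) × 𝔼 2).2 :=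
      continuous_snd.comp (continuous_subtype_val.comp continuous_snd)
    have ht : Continuous fun p : I × ↥puncturedModel ↦ (p.1 : ℝ) :=
      continuous_subtype_val.comp continuous_fst
    have hcoef : Continuous fun p : I × ↥puncturedModel ↦
        (1 - (p.1 : ℝ)) / (2 * ‖(p.2 : (𝕊 1) × 𝔼 2).2‖) + (p.1 : ℝ) :=
      ((continuous_const.sub ht).div (continuous_const.mul (continuous_norm.comp h2)) fun p ↦
        mul_ne_zero two_ne_zero (norm_ne_zero_iff.2 p.2.2)).add ht
    exact Continuous.subtype_mk (h1.prodMk (hcoef.smul h2)) _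
  · apply Subtype.ext
    show ((m.1.1, ((1 - 0) / (2 * ‖m.1.2‖) + 0) • m.1.2) : (𝕊 1) × 𝔼 2) = (torusIncl (torusRetr m) : (𝕊 1) × 𝔼 2)
    rw [torusIncl_apply_coe]
    simp only [torusRetr, ContinuousMap.coe_mk, Homeomorph.apply_symm_apply, unitOf, sub_zero,
      add_zero, smul_smul]
    congr 1
    ring
  · apply Subtype.ext
    show ((m.1.1, ((1 - 1) / (2 * ‖m.1.2‖) + 1) • m.1.2) : (𝕊 1) × 𝔼 2) = m.1
    simp

/-! ### Meridian circles of one knot in the complement of another -/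

namespace Knot.TubularNbhd

variable {K : Knot} (ν : Knot.TubularNbhd K)

/-- The meridian circle of `ν`, as a loop in the complement of another knot `J` missing the tube.
[folklore] -/
def meridianIn (J : Knot) (hJ : Disjoint (range ⇑J) (range ⇑ν)) :
    Path (⟨(ν.basePoint : 𝕊 3), fun h ↦ Set.disjoint_left.1 hJ h (mem_range_self _)⟩ : J.complement)
      ⟨(ν.basePoint : 𝕊 3), fun h ↦ Set.disjoint_left.1 hJ h (mem_range_self _)⟩ where
  toFun t := ⟨(ν.meridian t : 𝕊 3), fun h ↦ Set.disjoint_left.1 hJ h (by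
    rw [ν.coe_meridian_apply]; exact mem_range_self _)⟩
  continuous_toFun := Continuous.subtype_mk (continuous_subtype_val.comp ν.meridian.continuous) _
  source' := Subtype.ext (by simp)
  target' := Subtype.ext (by simp)

/-- The meridian loop in the other complement, as points of `S³`. [folklore] -/
@[simp] theorem coe_meridianIn_apply (J : Knot) (hJ : Disjoint (range ⇑J) (range ⇑ν)) (t : I) :
    ((ν.meridianIn J hJ t : J.complement) : 𝕊 3) = (ν.meridian t : 𝕊 3) := rfl

/-- The meridian disc of `ν` over the base angle, as a map of the open unit disc into the
complement of a knot `J` missing the tube. [folklore] -/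
def meridianDiscIn (J : Knot) (hJ : Disjoint (range ⇑J) (range ⇑ν)) :
    C(↥(ball (0 : 𝔼 2) 1), J.complement) where
  toFun w := ⟨ν (circlePoint 0, (w : 𝔼 2)), fun h ↦ Set.disjoint_left.1 hJ h (mem_range_self _)⟩
  continuous_toFun := by
    refine Continuous.subtype_mk ?_ _
    exact ν.isOpenEmbedding.continuous.comp (by fun_prop)

/-- **A meridian circle of `K` has winding number zero for every circle-valued map on `S³ ∖ J`**
(`J` missing the tube of `K`): it bounds its meridian disc inside the tube. [folklore] -/
theorem winding_meridianIn_eq_zero (J : Knot) (hJ : Disjoint (range ⇑J) (range ⇑ν))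
    (f : C(J.complement, Circle)) : CircleMaps.winding f (ν.meridianIn J hJ) = 0 := by
  have hc : ∀ t : I, (1 / 2 : ℝ) • ((circlePoint (2 * Real.pi * t) : 𝕊 1) : 𝔼 2) ∈ ball (0 : 𝔼 2) 1 := by
    intro t
    rw [mem_ball_zero_iff, norm_smul, norm_eq_of_mem_sphere, mul_one]
    norm_num
  refine CircleMaps.winding_eq_zero_of_factors_through_ball f (ν.meridianIn J hJ)
    (ν.meridianDiscIn J hJ) (fun t ↦ ⟨_, hc t⟩) (Continuous.subtype_mk (by fun_prop) _)
    (fun t ↦ Subtype.ext ?_) (Subtype.ext ?_)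
  · rfl
  · show (1 / 2 : ℝ) • ((circlePoint (2 * Real.pi * (0 : I)) : 𝕊 1) : 𝔼 2) =
      (1 / 2 : ℝ) • ((circlePoint (2 * Real.pi * (1 : I)) : 𝕊 1) : 𝔼 2)
    rw [Set.Icc.coe_zero, Set.Icc.coe_one, mul_zero, mul_one, ← zero_add (2 * Real.pi),
      circlePoint_add_two_pi]

end Knot.TubularNbhd

/-- The standard map `(x, u) ↦ (u, x^b)` as a pair of monomials. [folklore] -/
theorem CircleTorus.swap_comp_powFst_eq (b : ℤ) :
    CircleTorus.swap.comp (CircleTorus.powFst b) =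
      (CircleMaps.monomial 0 1).prodMk (CircleMaps.monomial b 0) := by
  ext1 z
  simp

/-- The standard map `(x, u) ↦ (x^a, u)` as a pair of monomials. [folklore] -/
theorem CircleTorus.powFst_eq (a : ℤ) :
    CircleTorus.powFst a = (CircleMaps.monomial a 0).prodMk (CircleMaps.monomial 0 1) := by
  ext1 z
  simp

/-! ### The symmetry theorem -/

namespace Knot.HasLinkingNumber

open CircleMaps CircleTorus

/-- **Symmetry of the linking number**, `lk(K, J) = lk(J, K)` — discharge of the named fact
`Literature.Topology.FourManifolds.Knot.HasLinkingNumber.symm` (D. Rolfsen, *Knots and Links*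
(1976), §5.D, Thm. 5.D.1 with definition (2): `lk(K, J) = [J] ∈ H₁(S³ ∖ K)`). Proof: the module
docstring — the boundary tori of the link exterior cancel in `H₂(S³ ∖ (K ∪ J))`, both come from one
model class by the orientation convention, and on the torus `T²` the two tube maps composed with
the circle maps `(Θ_K, Θ_J)` are homotopic to `(u, x^{lk(J,K)})` and `(x^{lk(K,J)}, u)`, acting as
`-lk(J, K)` and `lk(K, J)` on the torsion-free `H₂(T²; ℤ)`. [cite: Rolfsen1976, §5.D Thm 5.D.1] -/
theorem symm_holds : Knot.HasLinkingNumber.symm := by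
  intro K J hKJ l hl
  haveI : Knot.TubularNbhd.SmoothnessFacts := ⟨Knot.TubularNbhd.isSmoothEmbedding_pushOff_holds⟩
  -- (1) disjoint `0`-framed tubes
  obtain ⟨UK, UJ, hUKo, hUJo, hKU, hJU, hUU⟩ :=
    SeparatedNhds.of_isCompact_isCompact K.isCompact_range J.isCompact_range hKJ
  obtain ⟨νK₀, hνK₀⟩ := Knot.exists_tubularNbhd_range_subset K hUKo hKU
  obtain ⟨νJ₀, hνJ₀⟩ := Knot.exists_tubularNbhd_range_subset J hUJo hJU
  obtain ⟨νK, hνKr, hνK0⟩ := νK₀.exists_hasFraming_range_eq 0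
  obtain ⟨νJ, hνJr, hνJ0⟩ := νJ₀.exists_hasFraming_range_eq 0
  have hνKU : range ⇑νK ⊆ UK := hνKr ▸ hνK₀
  have hνJU : range ⇑νJ ⊆ UJ := hνJr ▸ hνJ₀
  have hdisj : Disjoint (range ⇑νK) (range ⇑νJ) := hUU.mono hνKU hνJU
  have hJνK : Disjoint (range ⇑J) (range ⇑νK) := (hdisj.mono_right νJ.range_knot_subset_range).symm
  have hKνJ : Disjoint (range ⇑K) (range ⇑νJ) := hdisj.mono_left νK.range_knot_subset_range
  -- (2) orientation, torus classes, the common model class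
  obtain ⟨μ⟩ := isOrientableOver_int_sphere_three
  have hcancel := Knot.TubularNbhd.map_torusClass_add_map_torusClass_eq_zero νK νJ hdisj μ
  have hne := νK.torusClass_ne_zero μ
  obtain ⟨τ, hτK, hτJ⟩ := Knot.TubularNbhd.exists_common_modelTorusClass νK νJ μ
  -- (3) circle maps
  obtain ⟨WK⟩ := Knot.TubularNbhd.WindingData.nonempty νK
  obtain ⟨WJ⟩ := Knot.TubularNbhd.WindingData.nonempty νJ
  set X' : Set (𝕊 3) := (range ⇑K ∪ range ⇑J)ᶜ with hX'
  have hX'K : X' ⊆ (range ⇑K)ᶜ := compl_subset_compl.2 subset_union_left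
  have hX'J : X' ⊆ (range ⇑J)ᶜ := compl_subset_compl.2 subset_union_right
  let Φ : C(↥X', CircleTorus) :=
    ⟨fun z ↦ (WK.Θ ⟨z, hX'K z.2⟩, WJ.Θ ⟨z, hX'J z.2⟩), by fun_prop⟩
  -- (4) the relation on the torus
  have hPK : range ⇑νK ∩ (range ⇑K)ᶜ ⊆ X' := νK.inter_compl_subset_compl_union νJ hdisj
  have hPJ : range ⇑νJ ∩ (range ⇑J)ᶜ ⊆ X' := νK.inter_compl_subset_compl_union' νJ hdisj
  set gK : C(↥puncturedModel, CircleTorus) := Φ.comp ((subsetInclusion hPK).comp νK.punct) with hgK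
  set gJ : C(↥puncturedModel, CircleTorus) := Φ.comp ((subsetInclusion hPJ).comp νJ.punct) with hgJ
  have hrel₀ : singularHomology.map ℤ ℤ gK 2 τ + singularHomology.map ℤ ℤ gJ 2 τ = 0 := by
    have := congrArg (singularHomology.map ℤ ℤ Φ 2) hcancel
    rw [map_add, map_zero, hτK, hτJ, ← ModuleCat.comp_apply, ← ModuleCat.comp_apply,
      ← ModuleCat.comp_apply, ← ModuleCat.comp_apply, ← singularHomology.map_comp,
      ← singularHomology.map_comp, ← singularHomology.map_comp, ← singularHomology.map_comp] at this
    exact this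
  set τ' : singularHomology ℤ ℤ CircleTorus 2 := singularHomology.map ℤ ℤ torusRetr 2 τ with hτ'
  have hretr : ∀ {Y : Type} [TopologicalSpace Y] (g : C(↥puncturedModel, Y)),
      singularHomology.map ℤ ℤ g 2 τ = singularHomology.map ℤ ℤ (g.comp torusIncl) 2 τ' := by
    intro Y _ g
    rw [hτ', ← ModuleCat.comp_apply, ← singularHomology.map_comp]
    have e : (g.comp torusIncl).comp torusRetr = g.comp (torusIncl.comp torusRetr) := rfl
    rw [e, singularHomology.map_comp, ModuleCat.comp_apply,
      singularHomology.map_eq_of_homotopic ℤ ℤ torusIncl_comp_torusRetr_homotopic 2,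
      singularHomology.map_id, ModuleCat.id_apply]
  have hτ'ne : τ' ≠ 0 := by
    intro h0
    apply hne
    rw [hτK, hretr νK.punct, h0, map_zero]
  set GK : C(CircleTorus, CircleTorus) := gK.comp torusIncl with hGK
  set GJ : C(CircleTorus, CircleTorus) := gJ.comp torusIncl with hGJ
  have hrel : singularHomology.map ℤ ℤ GK 2 τ' + singularHomology.map ℤ ℤ GJ 2 τ' = 0 := by
    rw [hGK, hGJ, ← hretr gK, ← hretr gJ]
    exact hrel₀
  -- (5) the loops of the torus parametrisation are the longitude and the meridian
  have hlongK : ∀ t : I, ((νK.punct (torusIncl (CircleMaps.inclFst (CircleMaps.stdLoop t)))) : 𝕊 3) =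
      (νK.longitude t : 𝕊 3) := fun t ↦ by
    rw [νK.punct_apply_coe, torusIncl_apply_coe, νK.coe_longitude_apply, CircleMaps.inclFst_apply,
      CircleMaps.stdLoop_apply, circleHomeomorphSphereOne_exp, circleHomeomorphSphereOne_one]
    rfl
  have hmerK : ∀ t : I, ((νK.punct (torusIncl (CircleMaps.inclSnd (CircleMaps.stdLoop t)))) : 𝕊 3) =
      (νK.meridian t : 𝕊 3) := fun t ↦ by
    rw [νK.punct_apply_coe, torusIncl_apply_coe, νK.coe_meridian_apply, CircleMaps.inclSnd_apply,
      CircleMaps.stdLoop_apply, circleHomeomorphSphereOne_exp, circleHomeomorphSphereOne_one]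
  have hlongJ : ∀ t : I, ((νJ.punct (torusIncl (CircleMaps.inclFst (CircleMaps.stdLoop t)))) : 𝕊 3) =
      (νJ.longitude t : 𝕊 3) := fun t ↦ by
    rw [νJ.punct_apply_coe, torusIncl_apply_coe, νJ.coe_longitude_apply, CircleMaps.inclFst_apply,
      CircleMaps.stdLoop_apply, circleHomeomorphSphereOne_exp, circleHomeomorphSphereOne_one]
    rfl
  have hmerJ : ∀ t : I, ((νJ.punct (torusIncl (CircleMaps.inclSnd (CircleMaps.stdLoop t)))) : 𝕊 3) =
      (νJ.meridian t : 𝕊 3) := fun t ↦ by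
    rw [νJ.punct_apply_coe, torusIncl_apply_coe, νJ.coe_meridian_apply, CircleMaps.inclSnd_apply,
      CircleMaps.stdLoop_apply, circleHomeomorphSphereOne_exp, circleHomeomorphSphereOne_one]
  -- (6) the push-offs and their linking numbers
  have hJL : Disjoint (range ⇑J) (range ⇑νK.pushOff) := hJνK.mono_right (by
    rintro _ ⟨x, rfl⟩; exact ⟨(x, framingBaseVector), (νK.pushOff_apply x).symm⟩)
  have hKL : Disjoint (range ⇑K) (range ⇑νJ.pushOff) := hKνJ.mono_right (by
    rintro _ ⟨x, rfl⟩; exact ⟨(x, framingBaseVector), (νJ.pushOff_apply x).symm⟩)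
  obtain ⟨b, hb, -⟩ := Knot.existsUnique_hasLinkingNumber_holds J νK.pushOff hJL
  have ha : K.HasLinkingNumber νJ.pushOff hKL l :=
    (Knot.TubularNbhd.hasLinkingNumber_pushOff_iff_right νJ hKνJ).1 hl
  -- (7) the four degrees of `G_K` and of `G_J`
  have dK₁₁ : CircleMaps.degree ((CircleMaps.fstC.comp GK).comp CircleMaps.inclFst) = 0 := by
    have hc : ∀ t, ((CircleMaps.fstC.comp GK).comp CircleMaps.inclFst) (CircleMaps.stdLoop t) =
        WK.Θ (νK.longitude t) := fun t ↦ congrArg WK.Θ (Subtype.ext (hlongK t))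
    rw [CircleMaps.degree, CircleMaps.winding_congr _ _ _ _ hc, WK.winding_Θ, WK.φ_longitude hνK0]
  have dK₁₂ : CircleMaps.degree ((CircleMaps.fstC.comp GK).comp CircleMaps.inclSnd) = 1 := by
    have hc : ∀ t, ((CircleMaps.fstC.comp GK).comp CircleMaps.inclSnd) (CircleMaps.stdLoop t) =
        WK.Θ (νK.meridian t) := fun t ↦ congrArg WK.Θ (Subtype.ext (hmerK t))
    rw [CircleMaps.degree, CircleMaps.winding_congr _ _ _ _ hc, WK.winding_Θ, WK.φ_meridian]
  have dK₂₁ : CircleMaps.degree ((CircleMaps.sndC.comp GK).comp CircleMaps.inclFst) = b := by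
    have hc : ∀ t, ((CircleMaps.sndC.comp GK).comp CircleMaps.inclFst) (CircleMaps.stdLoop t) =
        WJ.Θ ((J.loopInCompl νK.pushOff hJL) t) := fun t ↦ congrArg WJ.Θ (Subtype.ext (hlongK t))
    rw [CircleMaps.degree, CircleMaps.winding_congr _ _ _ _ hc, WJ.winding_loopInCompl hJL hb]
  have dK₂₂ : CircleMaps.degree ((CircleMaps.sndC.comp GK).comp CircleMaps.inclSnd) = 0 := by
    have hc : ∀ t, ((CircleMaps.sndC.comp GK).comp CircleMaps.inclSnd) (CircleMaps.stdLoop t) =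
        WJ.Θ ((νK.meridianIn J hJνK) t) := fun t ↦ congrArg WJ.Θ (Subtype.ext (hmerK t))
    rw [CircleMaps.degree, CircleMaps.winding_congr _ _ _ _ hc, νK.winding_meridianIn_eq_zero J hJνK WJ.Θ]
  have dJ₁₁ : CircleMaps.degree ((CircleMaps.fstC.comp GJ).comp CircleMaps.inclFst) = l := by
    have hc : ∀ t, ((CircleMaps.fstC.comp GJ).comp CircleMaps.inclFst) (CircleMaps.stdLoop t) =
        WK.Θ ((K.loopInCompl νJ.pushOff hKL) t) := fun t ↦ congrArg WK.Θ (Subtype.ext (hlongJ t))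
    rw [CircleMaps.degree, CircleMaps.winding_congr _ _ _ _ hc, WK.winding_loopInCompl hKL ha]
  have dJ₁₂ : CircleMaps.degree ((CircleMaps.fstC.comp GJ).comp CircleMaps.inclSnd) = 0 := by
    have hc : ∀ t, ((CircleMaps.fstC.comp GJ).comp CircleMaps.inclSnd) (CircleMaps.stdLoop t) =
        WK.Θ ((νJ.meridianIn K hKνJ) t) := fun t ↦ congrArg WK.Θ (Subtype.ext (hmerJ t))
    rw [CircleMaps.degree, CircleMaps.winding_congr _ _ _ _ hc, νJ.winding_meridianIn_eq_zero K hKνJ WK.Θ]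
  have dJ₂₁ : CircleMaps.degree ((CircleMaps.sndC.comp GJ).comp CircleMaps.inclFst) = 0 := by
    have hc : ∀ t, ((CircleMaps.sndC.comp GJ).comp CircleMaps.inclFst) (CircleMaps.stdLoop t) =
        WJ.Θ (νJ.longitude t) := fun t ↦ congrArg WJ.Θ (Subtype.ext (hlongJ t))
    rw [CircleMaps.degree, CircleMaps.winding_congr _ _ _ _ hc, WJ.winding_Θ, WJ.φ_longitude hνJ0]
  have dJ₂₂ : CircleMaps.degree ((CircleMaps.sndC.comp GJ).comp CircleMaps.inclSnd) = 1 := by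
    have hc : ∀ t, ((CircleMaps.sndC.comp GJ).comp CircleMaps.inclSnd) (CircleMaps.stdLoop t) =
        WJ.Θ (νJ.meridian t) := fun t ↦ congrArg WJ.Θ (Subtype.ext (hmerJ t))
    rw [CircleMaps.degree, CircleMaps.winding_congr _ _ _ _ hc, WJ.winding_Θ, WJ.φ_meridian]
  -- (8) the homotopy classes and their actions on `H₂(T²; ℤ)`
  have eK : GK = (CircleMaps.fstC.comp GK).prodMk (CircleMaps.sndC.comp GK) := by ext1 z; rfl
  have eJ : GJ = (CircleMaps.fstC.comp GJ).prodMk (CircleMaps.sndC.comp GJ) := by ext1 z; rfl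
  have hhK := CircleMaps.homotopic_prodMk_of_degree (CircleMaps.fstC.comp GK) (CircleMaps.sndC.comp GK)
    dK₁₁ dK₁₂ dK₂₁ dK₂₂
  have hhJ := CircleMaps.homotopic_prodMk_of_degree (CircleMaps.fstC.comp GJ) (CircleMaps.sndC.comp GJ)
    dJ₁₁ dJ₁₂ dJ₂₁ dJ₂₂
  rw [← eK, ← CircleTorus.swap_comp_powFst_eq] at hhK
  rw [← eJ, ← CircleTorus.powFst_eq] at hhJ
  rw [singularHomology.map_eq_of_homotopic ℤ ℤ hhK 2, singularHomology.map_eq_of_homotopic ℤ ℤ hhJ 2,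
    CircleTorus.map_swap_comp_powFst, CircleTorus.map_powFst] at hrel
  -- (9) `(l - b) τ' = 0`, so `b = l`
  have hbl : b = l := by
    by_contra hne'
    have h0 : (l - b) • τ' = 0 := by
      rw [sub_zsmul, ← hrel]
      abel
    exact hτ'ne (CircleTorus.eq_zero_of_zsmul_eq_zero (sub_ne_zero.2 (Ne.symm hne')) τ' h0)
  -- (10) conclude through the push-off
  subst hbl
  exact (Knot.TubularNbhd.hasLinkingNumber_pushOff_iff_right νK hJνK).2 hb

end Knot.HasLinkingNumber

end Literature.Topology.FourManifolds
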